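import Summits.AtomisticToContinuum.HydrodynamicLimit.Theses.StiffCollisionalRelaxation
import Literature.MathematicalPhysics.KineticTheory.HardSphereEuler
import Literature.Analysis.FunctionSpaces.FlatTorus
import HarnessLib

/-!
# The dock's hot-cell functional is free on a kinetic range box

Helper file (`--supports stmt-AtomisticToContinuum-14827`, line `Sketch`, lead c3, cycle 4) recording, kernel-checked, the
structural remark of the cycle-4 status card: the ONLY use that the route's dock `EulerRelEntropyDock` makes of component (i)
of the crux `AprioriBounds` is to produce the hot-cell functional hypothesis of `RelEntropyStability`,
`∀ M ≥ 1, ∫_{s ∈ [0,t₁]} ∫ₓ 𝟙(M·ρ < E)(E^{3/2}/√ρ + E + ρ) ≤ Cexp · e^{-λ M}` (there `λ, Cexp` are universally quantified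
parameters, chosen by the dock).  On a KINETIC RANGE BOX — `c ≤ ρ ≤ C_ρ`, `E ≤ C_E` at every `(s, x) ∈ [0, t₁] × 𝕋³`, which is
exactly what the sibling crux `GermanoSplitLES.KineticRangeControl` (stmt-AtomisticToContinuum-9201) delivers w.h.p. for the
block fields and which already implies component (ii) (`partTwo_of_kineticRangeControl`, p121015) — this hypothesis holds for
free with `λ := 1` and `Cexp := t₁ · (C_E^{3/2}/√c + C_E + C_ρ) · e^{C_E/c}`: the cell `{M·ρ < E}` is EMPTY once `M ≥ C_E/c`,
and below that the integrand is bounded by `C_E^{3/2}/√c + C_E + C_ρ` while `e^{C_E/c - M} ≥ 1`.  Consequence for the planner: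
in route `StiffCollisionalRelaxation` the binder `AprioriBounds` of the dock can be re-keyed to `KineticRangeControl`, retiring
component (i) (the `HighMomentumCutoff`-type statement) from this route.

* `hotCell_integrand_le`, `hotCell_integrand_eq_zero` — the pointwise bound / vanishing of the integrand on the box;
* `hotCell_of_box` — the dock's hypothesis in its exact syntactic shape (`(U s x).2.2 ^ (3/2 : ℝ) / Real.sqrt ((U s x).1) + …`,
  `Cexp * Real.exp (-(lam * M))` with `lam = 1`), for an ARBITRARY field `U : ℝ → 𝕋³ → ℝ × V3 × ℝ` in the box (no measurability
  needed: upper bounds of Bochner integrals by integrable constants).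

No new definitions, no named facts; axioms `propext`, `Classical.choice`, `Quot.sound`.
-/

noncomputable section

open MeasureTheory Filter Set Topology

namespace Summit.AtomisticToContinuum.HydrodynamicLimit.Theorems.AdiabatCeiling

open Literature.MathematicalPhysics.KineticTheory Literature.Analysis.FluidPDE

/-- Pointwise bound: on the box `c ≤ ρ ≤ C_ρ`, `E ≤ C_E` (`0 < c`, `0 ≤ C_E`), for `1 ≤ M` the hot-cell integrand
`𝟙(Mρ < E)(E^{3/2}/√ρ + E + ρ)` is at most `C_E^{3/2}/√c + C_E + C_ρ`. -/
theorem hotCell_integrand_le {c Cρ CE M ρ E : ℝ} (hc : 0 < c) (hCE : 0 ≤ CE) (hM : 1 ≤ M)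
    (hρ : c ≤ ρ) (hρ' : ρ ≤ Cρ) (hE : E ≤ CE) :
    (if M * ρ < E then E ^ (3 / 2 : ℝ) / Real.sqrt ρ + E + ρ else 0) ≤
      CE ^ (3 / 2 : ℝ) / Real.sqrt c + CE + Cρ := by
  have hρpos : 0 < ρ := hc.trans_le hρ
  have hsc : 0 < Real.sqrt c := Real.sqrt_pos.2 hc
  have hB1 : 0 ≤ CE ^ (3 / 2 : ℝ) / Real.sqrt c := div_nonneg (Real.rpow_nonneg hCE _) hsc.le
  split_ifs with h
  · have hE0 : 0 ≤ E := by nlinarith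
    have h1 : E ^ (3 / 2 : ℝ) ≤ CE ^ (3 / 2 : ℝ) := Real.rpow_le_rpow hE0 hE (by norm_num)
    have h2 : Real.sqrt c ≤ Real.sqrt ρ := Real.sqrt_le_sqrt hρ
    have h3 : E ^ (3 / 2 : ℝ) / Real.sqrt ρ ≤ CE ^ (3 / 2 : ℝ) / Real.sqrt c :=
      div_le_div₀ (Real.rpow_nonneg hCE _) h1 hsc h2
    linarith
  · nlinarith

/-- Pointwise vanishing: on the box, the hot cell `{Mρ < E}` is empty as soon as `C_E ≤ M c`. -/
theorem hotCell_integrand_eq_zero {c CE M ρ E : ℝ} (hM : 0 ≤ M) (hρ : c ≤ ρ) (hE : E ≤ CE)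
    (hCEM : CE ≤ M * c) :
    (if M * ρ < E then E ^ (3 / 2 : ℝ) / Real.sqrt ρ + E + ρ else 0) = 0 := by
  rw [if_neg]
  intro h
  have : M * c ≤ M * ρ := mul_le_mul_of_nonneg_left hρ hM
  linarith

/-- **The hot-cell functional of `RelEntropyStability` is free on a kinetic range box.**  For any field
`U : ℝ → 𝕋³ → ℝ × V3 × ℝ` with `c ≤ (U s x).1 ≤ C_ρ` and `(U s x).2.2 ≤ C_E` on `[0, t₁] × 𝕋³` (`0 < c`, `0 ≤ C_E`, `0 ≤ t₁`),
and every `M ≥ 1`: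
`∫_{s ∈ [0,t₁]} ∫ₓ 𝟙(M (U s x).1 < (U s x).2.2)((U s x).2.2^{3/2}/√(U s x).1 + (U s x).2.2 + (U s x).1)
  ≤ (t₁ (C_E^{3/2}/√c + C_E + C_ρ) e^{C_E/c}) · e^{-(1·M)}` — the exact syntactic shape of the dock's hypothesis with `lam = 1`. -/
theorem hotCell_of_box : ∀ {t₁ c Cρ CE : ℝ}, 0 ≤ t₁ → 0 < c → 0 ≤ CE → ∀ (U : ℝ → T3 → ℝ × V3 × ℝ), (∀ s ∈ Icc 0 t₁, ∀ x, c ≤ (U s x).1 ∧ (U s x).1 ≤ Cρ ∧ (U s x).2.2 ≤ CE) → ∀ M : ℝ, 1 ≤ M → (∫ s in Icc 0 t₁, ∫ x, (if M * (U s x).1 < (U s x).2.2 then (U s x).2.2 ^ (3 / 2 : ℝ) / Real.sqrt ((U s x).1) + (U s x).2.2 + (U s x).1 else 0)) ≤ (t₁ * (CE ^ (3 / 2 : ℝ) / Real.sqrt c + CE + Cρ) * Real.exp (CE / c)) * Real.exp (-(1 * M)) := by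
  intro t₁ c Cρ CE ht hc hCE U hbox M hM
  haveI : IsProbabilityMeasure (volume : Measure T3) := by
    rw [volume_pi]; infer_instance
  set B : ℝ := CE ^ (3 / 2 : ℝ) / Real.sqrt c + CE + Cρ with hB
  set F : ℝ → T3 → ℝ := fun s x => if M * (U s x).1 < (U s x).2.2 then
      (U s x).2.2 ^ (3 / 2 : ℝ) / Real.sqrt ((U s x).1) + (U s x).2.2 + (U s x).1 else 0 with hF
  have hCρ : ∀ s ∈ Icc 0 t₁, 0 < Cρ := fun s hs => by
    obtain ⟨h1, h2, -⟩ := hbox s hs 0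
    exact hc.trans_le (h1.trans h2)
  -- nonnegativity of the integrand on the box
  have hF0 : ∀ s ∈ Icc 0 t₁, ∀ x, 0 ≤ F s x := by
    intro s hs x
    obtain ⟨h1, -, -⟩ := hbox s hs x
    simp only [hF]
    split_ifs with h
    · have hρ : 0 < (U s x).1 := hc.trans_le h1
      have hE : 0 ≤ (U s x).2.2 := by nlinarith
      positivity
    · exact le_rfl
  by_cases hcase : CE ≤ M * c
  · -- the hot cell is empty: the functional vanishes
    have hzero : ∀ s ∈ Icc 0 t₁, (∫ x, F s x) = 0 := by
      intro s hs
      have : (fun x => F s x) = fun _ => (0 : ℝ) := by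
        funext x
        obtain ⟨h1, -, h3⟩ := hbox s hs x
        exact hotCell_integrand_eq_zero (by linarith) h1 h3 hcase
      rw [this, integral_zero]
    have h0 : (∫ s in Icc 0 t₁, ∫ x, F s x) = 0 := by
      rw [setIntegral_congr_fun measurableSet_Icc hzero, integral_zero]
    have hrhs : 0 ≤ (t₁ * B * Real.exp (CE / c)) * Real.exp (-(1 * M)) := by
      have hB0 : 0 ≤ B := by
        rcases eq_or_lt_of_le ht with h | h
        · -- B ≥ 0 from 0 ≤ CE and Cρ > 0 (box at s = 0 ∈ Icc 0 t₁)
          have := hCρ 0 ⟨le_rfl, ht⟩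
          have : 0 ≤ CE ^ (3 / 2 : ℝ) / Real.sqrt c := div_nonneg (Real.rpow_nonneg hCE _) (Real.sqrt_nonneg _)
          rw [hB]; linarith
        · have := hCρ 0 ⟨le_rfl, ht⟩
          have : 0 ≤ CE ^ (3 / 2 : ℝ) / Real.sqrt c := div_nonneg (Real.rpow_nonneg hCE _) (Real.sqrt_nonneg _)
          rw [hB]; linarith
      positivity
    simpa [hF] using h0.le.trans hrhs
  · -- the hot cell may be nonempty, but then `M < C_E/c`: bound the integrand by `B` and use `e^{C_E/c - M} ≥ 1`
    push Not at hcase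
    have hB0 : 0 ≤ B := by
      have := hCρ 0 ⟨le_rfl, ht⟩
      have : 0 ≤ CE ^ (3 / 2 : ℝ) / Real.sqrt c := div_nonneg (Real.rpow_nonneg hCE _) (Real.sqrt_nonneg _)
      rw [hB]; linarith
    have hinner : ∀ s ∈ Icc 0 t₁, (∫ x, F s x) ≤ B := by
      intro s hs
      have hle : ∀ x, F s x ≤ B := fun x => by
        obtain ⟨h1, h2, h3⟩ := hbox s hs x
        simpa [hF, hB] using hotCell_integrand_le hc hCE hM h1 h2 h3
      calc (∫ x, F s x) ≤ ∫ _x : T3, B :=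
            integral_mono_of_nonneg (ae_of_all _ (hF0 s hs)) (integrable_const B) (ae_of_all _ hle)
        _ = B := by simp
    have houter : (∫ s in Icc 0 t₁, ∫ x, F s x) ≤ t₁ * B := by
      have hnn : 0 ≤ᵐ[volume.restrict (Icc 0 t₁)] fun s => ∫ x, F s x := by
        rw [EventuallyLE, ae_restrict_iff' measurableSet_Icc]
        exact ae_of_all _ fun s hs => integral_nonneg (hF0 s hs)
      have hle : (fun s => ∫ x, F s x) ≤ᵐ[volume.restrict (Icc 0 t₁)] fun _ => B := by
        rw [EventuallyLE, ae_restrict_iff' measurableSet_Icc]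
        exact ae_of_all _ hinner
      calc (∫ s in Icc 0 t₁, ∫ x, F s x) ≤ ∫ _s in Icc 0 t₁, B :=
            integral_mono_of_nonneg hnn (integrable_const B) hle
        _ = t₁ * B := by
            rw [setIntegral_const, Real.volume_real_Icc_of_le ht, sub_zero, smul_eq_mul]
    have hexp : 1 ≤ Real.exp (CE / c) * Real.exp (-(1 * M)) := by
      rw [← Real.exp_add]
      apply Real.one_le_exp
      have : M ≤ CE / c := by rw [le_div_iff₀ hc]; linarith
      linarith
    calc (∫ s in Icc 0 t₁, ∫ x, F s x) ≤ t₁ * B := houter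
      _ = t₁ * B * 1 := by ring
      _ ≤ t₁ * B * (Real.exp (CE / c) * Real.exp (-(1 * M))) :=
          mul_le_mul_of_nonneg_left hexp (mul_nonneg ht hB0)
      _ = (t₁ * B * Real.exp (CE / c)) * Real.exp (-(1 * M)) := by ring

end Summit.AtomisticToContinuum.HydrodynamicLimit.Theorems.AdiabatCeiling
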